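import Literature.NumberTheory.Automorphic.ResGLnConeDictionary
import Literature.NumberTheory.Automorphic.AdelicGLnGlueProofs
import Literature.RepresentationTheory.CompactGroups.UnitaryTrick
import HarnessLib

/-!
# A `K_∞`-invariant positive definite Hermitian form on `E_λ(ℂ) ⊗ ε_S` —
crux HeckeEigenvalueField (stmt-Langlands-13632), line Sketch, stub INNER

Statement.  For the archimedean coefficient representation `σSK = (E_λ(ℂ) ⊗ ε_S)|_{K_∞}`
(`ConeDictionary.σSK hcpt S λ`) of the maximal compact subgroup
`K_∞ = ∏_{w real} O(n) × ∏_{w complex} U(n)` of `GL_n(K_∞)` (over the datum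
`AutomorphyDatum.gl n K hcpt`) there is a positive definite Hermitian form `ip` on
`ResGLnCohomology.CoeffModule ℂ n K λ`, linear in the first and conjugate-linear in the second
variable, with `ip (σSK k v) (σSK k w) = ip v w` for all `k ∈ K_∞`.  It is what makes the adjoint
`d*` of the finite-dimensional relative `(𝔤, K_∞)`-complex `K_∞`-equivariant.

Proof (Weyl's unitarian trick, Bröcker–tom Dieck II.(1.7)).  `K_∞` is compact
(`isCompact_Kinf_holds`), `E_λ(ℂ)` is finite-dimensional
(`ResGLnCohomology.finiteDimensional_coeffModule`) and the matrix coefficients `k ↦ ℓ (σSK k v)` are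
continuous (`ResGLnCohomology.isGKModule_archCoeffSign`, field `weaklyContinuous`).  In the basis
`Module.finBasis`, `σSK` becomes a continuous matrix representation `ρ : K_∞ →* M_d(ℂ)`; the tree's
averaged Gram matrix `P = ∫_{K_∞} ρ(k)ᴴ ρ(k) dk` for the Haar probability measure
(`CompactGroup.gramAverage`) is Hermitian, positive definite and `ρ`-invariant,
`ρ(k)ᴴ P ρ(k) = P` (`CompactGroup.gramAverage_isHermitian`, `CompactGroup.gramAverage_posDef`,
`CompactGroup.conjTranspose_mul_gramAverage_mul`), and `ip v w = [w]ᴴ P [v]` is the required form.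

## References

* T. Bröcker, T. tom Dieck, *Representations of compact Lie groups*, GTM 98 (1985), II.(1.7).
  [BrockerTomDieck1985]
* A. Borel, N. Wallach, *Continuous cohomology, discrete subgroups, and representations of
  reductive groups*, 2nd ed. (2000), I §1.3, II §2.2. [BorelWallach2000]
-/

set_option linter.dupNamespace false -- project-wide: `Summit.Langlands.Langlands` is the mandated namespace

noncomputable section

open scoped Classical ComplexOrder Matrix
open NumberField NumberField.mixedEmbedding MeasureTheory
open Literature.NumberTheory.Automorphic Literature.RepresentationTheory.CompactGroups

namespace Summit.Langlands.Langlands.Theorems.HeckeEigenvalueField.Res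

/-- **Weyl's unitarian trick, coordinate-free form.**  A representation `σ` of a compact group `G`
on a finite-dimensional complex vector space `E` whose matrix coefficients `g ↦ ℓ (σ g v)` are
continuous admits a `G`-invariant positive definite Hermitian form (linear in the first,
conjugate-linear in the second variable): in a basis `b`, `⟨v, w⟩ = [w]ᴴ P [v]` with
`P = ∫_G ρ(g)ᴴ ρ(g) dg` the averaged Gram matrix of the matrix form `ρ = [σ]_b` of `σ`
(`CompactGroup.gramAverage` for the Haar probability measure on the Borel σ-algebra).
[cite: BrockerTomDieck1985, II.(1.7)] -/
theorem exists_invariantForm_of_compactSpace {G : Type*} [Group G] [TopologicalSpace G]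
    [IsTopologicalGroup G] [CompactSpace G] {E : Type*} [AddCommGroup E] [Module ℂ E]
    [FiniteDimensional ℂ E] (σ : Representation ℂ G E)
    (hσ : ∀ (v : E) (ℓ : Module.Dual ℂ E), Continuous fun g : G => ℓ (σ g v)) :
    ∃ ip : E → E → ℂ,
      (∀ u v w, ip (u + v) w = ip u w + ip v w) ∧ (∀ (z : ℂ) v w, ip (z • v) w = z * ip v w) ∧
      (∀ v w, ip v w = (starRingEnd ℂ) (ip w v)) ∧ (∀ v, v ≠ 0 → 0 < (ip v v).re) ∧
      ∀ (g : G) (v w : E), ip (σ g v) (σ g w) = ip v w := by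
  borelize G
  -- the matrix form `ρ = [σ]_b` of `σ` in a basis `b`
  let b : Module.Basis (Fin (Module.finrank ℂ E)) ℂ E := Module.finBasis ℂ E
  let ρ : G →* Matrix (Fin (Module.finrank ℂ E)) (Fin (Module.finrank ℂ E)) ℂ :=
    { toFun := fun g => LinearMap.toMatrix b b (σ g)
      map_one' := by rw [map_one, LinearMap.toMatrix_one]
      map_mul' := fun g h => by rw [map_mul, LinearMap.toMatrix_mul] }
  have hρ_apply : ∀ g : G, ρ g = LinearMap.toMatrix b b (σ g) := fun _ => rfl
  have hρ : Continuous ρ := by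
    refine continuous_matrix fun i j => ?_
    simp only [hρ_apply, LinearMap.toMatrix_apply]
    exact hσ (b j) (b.coord i)
  have hrepr : ∀ (g : G) (v : E),
      (⇑(b.repr (σ g v)) : Fin (Module.finrank ℂ E) → ℂ) = ρ g *ᵥ ⇑(b.repr v) :=
    fun g v => (LinearMap.toMatrix_mulVec_repr b b (σ g) v).symm
  -- the averaged Gram matrix `P = ∫ ρ(g)ᴴ ρ(g) dg` (Haar probability measure of `G`)
  let μ : Measure G := Measure.haarMeasure ⊤
  have hH : (CompactGroup.gramAverage μ ρ).IsHermitian := CompactGroup.gramAverage_isHermitian μ ρ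
  have hP : (CompactGroup.gramAverage μ ρ).PosDef := CompactGroup.gramAverage_posDef μ ρ hρ
  have hinv : ∀ g : G, (ρ g)ᴴ * CompactGroup.gramAverage μ ρ * ρ g = CompactGroup.gramAverage μ ρ :=
    CompactGroup.conjTranspose_mul_gramAverage_mul μ ρ hρ
  refine ⟨fun v w => star (⇑(b.repr w)) ⬝ᵥ (CompactGroup.gramAverage μ ρ *ᵥ ⇑(b.repr v)),
    ?_, ?_, ?_, ?_, ?_⟩
  · -- additivity in the first variable
    intro u v w
    simp only [map_add, Finsupp.coe_add, Matrix.mulVec_add, dotProduct_add]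
  · -- homogeneity in the first variable
    intro z v w
    simp only [map_smul, Finsupp.coe_smul, Matrix.mulVec_smul, dotProduct_smul, smul_eq_mul]
  · -- Hermitian symmetry (`Pᴴ = P`)
    intro v w
    dsimp only
    rw [starRingEnd_apply, ← Matrix.star_dotProduct_star, star_star, Matrix.star_mulVec, hH.eq,
      ← Matrix.dotProduct_mulVec]
  · -- positivity (`P` is positive definite)
    intro v hv
    have hx : (⇑(b.repr v) : Fin (Module.finrank ℂ E) → ℂ) ≠ 0 := fun h =>
      hv (b.repr.map_eq_zero_iff.mp (Finsupp.coe_eq_zero.mp h))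
    have hpos := (Complex.lt_def.1 (hP.dotProduct_mulVec_pos hx)).1
    rwa [Complex.zero_re] at hpos
  · -- invariance (`ρ(g)ᴴ P ρ(g) = P`)
    intro g v w
    dsimp only
    rw [hrepr g v, hrepr g w, Matrix.star_mulVec, Matrix.mulVec_mulVec, ← Matrix.dotProduct_mulVec,
      Matrix.mulVec_mulVec, ← Matrix.mul_assoc, hinv g]

/-- **Stub INNER — a `K_∞`-invariant positive definite Hermitian form on the coefficients
`E_λ(ℂ) ⊗ ε_S`.**  The restriction `σSK` of `E_λ(ℂ) ⊗ ε_S` to the compact group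
`K_∞ = ∏ O(n) × ∏ U(n)` (`isCompact_Kinf_holds`) is a representation on the finite-dimensional
space `ResGLnCohomology.CoeffModule ℂ n K λ` (`ResGLnCohomology.finiteDimensional_coeffModule`)
with continuous matrix coefficients (`ResGLnCohomology.isGKModule_archCoeffSign`), so Weyl's
unitarian trick (`exists_invariantForm_of_compactSpace`: average a Hermitian form over `K_∞` against
the Haar probability measure) gives a `K_∞`-invariant positive definite Hermitian form.
[cite: BorelWallach2000, I §1.3 and II §2.2] [cite: BrockerTomDieck1985, II.(1.7)] -/
theorem stub_exists_invariantInnerProduct {n : ℕ} {K : Type} [Field K] [NumberField K]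
    (hcpt : isCompact_glFiniteIntegralLevel n K) (S : Finset {w : InfinitePlace K // w.IsReal})
    (lam : (K →+* ℂ) → Fin n → ℤ) :
    ∃ ip : ResGLnCohomology.CoeffModule ℂ n K lam → ResGLnCohomology.CoeffModule ℂ n K lam → ℂ,
      (∀ u v w, ip (u + v) w = ip u w + ip v w) ∧ (∀ (z : ℂ) v w, ip (z • v) w = z * ip v w) ∧
      (∀ v w, ip v w = (starRingEnd ℂ) (ip w v)) ∧ (∀ v, v ≠ 0 → 0 < (ip v v).re) ∧
      ∀ (k : (AutomorphyDatum.gl n K hcpt).arch.maximalCompact) (v w : ResGLnCohomology.CoeffModule ℂ n K lam),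
        ip (ConeDictionary.σSK hcpt S lam k v) (ConeDictionary.σSK hcpt S lam k w) = ip v w := by
  haveI : CompactSpace (AutomorphyDatum.gl n K hcpt).arch.maximalCompact :=
    isCompact_iff_compactSpace.mp (isCompact_Kinf_holds n K)
  haveI : FiniteDimensional ℂ (ResGLnCohomology.CoeffModule ℂ n K lam) :=
    ResGLnCohomology.finiteDimensional_coeffModule n K lam
  exact exists_invariantForm_of_compactSpace (ConeDictionary.σSK hcpt S lam)
    (ResGLnCohomology.isGKModule_archCoeffSign n K S lam).weaklyContinuous

end Summit.Langlands.Langlands.Theorems.HeckeEigenvalueField.Res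

end
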